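import Literature.AnabelianGeometry.EtaleTheta.Discharge.Sec2OddBijectivityProofs

/-!
# [EtTh] §2, Corollary 2.18 (iv): the fibre group `Hom(Π^tp_Y/Π^tp_Ÿ, μ_N)` has `1` resp. `2` elements, and
# distinct twists are not `μ_N`-conjugate (proof-only companion of `ThetaRigidity.lean` / `MonoThetaEnv.lean`)

Mochizuki, *The Étale Theta Function and its Frobenioid-theoretic Manifestations* [EtTh], Publ. RIMS 45 (2009),
§2, Cor 2.18 (iv) pp.61–63: "`Ker(Aut^μ(M•) → Aut(Π•_X))` … is naturally isomorphic to
`Hom(Π•_Y/Π•_Ÿ, Ker(Π• ↠ Π•_Y))` — a group of cardinality one (respectively, two) if `N` is odd (respectively,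
even)" (locators `p.N` = PDF pages of the PRIMS text; bib key `MochizukiEtTh2009`). PROOF-ONLY companion (no `def`,
no new named fact) of abc-iut-L2-t2's `ThetaRigidity.lean` / `MonoThetaEnv.lean` (nothing there is edited or
restated); seat abc-iut-w4-d008 (consumer: the [IUTchII] Prop. 1.2 (i) indeterminacy clause,
`Literature/IUT/HodgeArakelov/MonoThetaFromGroupsProofs.lean`). Pure group theory over the interface
`ThetaEnvData N` (`μ_N` cyclic of order `N`, `[Π^tp_Y : Π^tp_Ÿ] = 2`):

* `mu_eq_one_of_mul_self_eq_one_of_odd`, `exists_mu_ne_one_mul_self_eq_one_of_not_odd`,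
  `mu_eq_one_or_eq_of_mul_self_eq_one` — the `2`-torsion `μ_N[2]` is trivial for `N` odd and `{1, ζ}` for `N` even;
* `homKill_eq_one_of_odd`, `homKill_eq_one_or_eq` — hence `Hom(Π^tp_Y/Π^tp_Ÿ, μ_N)` is `{1}` resp. `{1, φ₀}`
  ("cardinality one (respectively, two)");
* `eq_of_conj_twist_eq` — the twists `x ↦ φ(x̄)·x` by DISTINCT members `φ` are never `μ_N`-conjugate, so the
  `μ_N`-conjugacy classes of the fibre are in bijection with `Hom(Π^tp_Y/Π^tp_Ÿ, μ_N)` itself: the quotient `φ/ψ`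
  would be the coboundary of an element of `μ_N` fixed by `Π^tp_Ÿ`, hence (input `Π^tp_Ÿ ↠ G_K`, i.e. `K = K̈`,
  p.41; the `RigidData` axiom `augYdd_surjective`) by `G_K`, hence trivial.

HONEST FRAMING: no side is taken on [IUTchIII] Cor 3.12; typed ≠ discharged elsewhere.
-/

namespace Literature.AnabelianGeometry.EtaleTheta

universe u

namespace ThetaEnvData

variable {N : ℕ+} (T : ThetaEnvData.{u} N)

/-! ## The `2`-torsion of the cyclotome `μ_N` (cyclic of order `N`) -/

/-- For `N` odd the cyclic group `μ_N` has no element of order `2` ("of order `1` … if `N` is odd",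
[IUTchII] Prop. 1.2 (i); [EtTh] Cor. 2.18 (iv) "cardinality one"). [cite: MochizukiEtTh2009, Cor 2.18(iv) p.61] -/
theorem mu_eq_one_of_mul_self_eq_one_of_odd (hodd : Odd ((N : ℕ+) : ℕ)) {a : T.mu} (ha : a * a = 1) : a = 1 := by
  have h2 : orderOf a ∣ 2 := orderOf_dvd_of_pow_eq_one (by rw [pow_two, ha])
  have hN : orderOf a ∣ ((N : ℕ+) : ℕ) := by
    rw [← T.card_mu]
    exact orderOf_dvd_card
  exact orderOf_eq_one_iff.mp (Nat.eq_one_of_dvd_coprimes (Nat.coprime_two_left.mpr hodd) h2 hN)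

/-- For `N` even the cyclic group `μ_N` has an element of order exactly `2` ("of order … `2` if `N` is even",
[IUTchII] Prop. 1.2 (i); [EtTh] Cor. 2.18 (iv) "cardinality … two"). [cite: MochizukiEtTh2009, Cor 2.18(iv) p.61] -/
theorem exists_mu_ne_one_mul_self_eq_one_of_not_odd (hN : ¬ Odd ((N : ℕ+) : ℕ)) :
    ∃ ζ : T.mu, ζ ≠ 1 ∧ ζ * ζ = 1 := by
  haveI := T.mu_cyclic
  obtain ⟨g, hg⟩ := IsCyclic.exists_ofOrder_eq_natCard (α := T.mu)
  rw [Nat.card_eq_fintype_card, T.card_mu] at hg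
  obtain ⟨k, hk⟩ := Nat.not_odd_iff_even.mp hN
  refine ⟨g ^ k, fun h => ?_, ?_⟩
  · have hd : orderOf g ∣ k := orderOf_dvd_of_pow_eq_one h
    rw [hg] at hd
    have hk0 : 0 < k := by have := N.pos; omega
    have := Nat.le_of_dvd hk0 hd
    omega
  · rw [← pow_add, ← hk, ← hg, pow_orderOf_eq_one]

/-- In the cyclic group `μ_N` an element `ζ` of order `2` exhausts the non-trivial `2`-torsion: `a² = 1 ⇒ a ∈ {1, ζ}`
(a cyclic group has at most two square roots of `1`). [cite: MochizukiEtTh2009, Cor 2.18(iv) p.61] -/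
theorem mu_eq_one_or_eq_of_mul_self_eq_one {ζ : T.mu} (hζ1 : ζ ≠ 1) (hζ : ζ * ζ = 1) {a : T.mu}
    (ha : a * a = 1) : a = 1 ∨ a = ζ := by
  classical
  by_contra h
  push Not at h
  haveI := T.mu_cyclic
  have hle := IsCyclic.card_pow_eq_one_le (α := T.mu) (n := 2) two_pos
  have h1 : (1 : T.mu) ∉ ({ζ, a} : Finset T.mu) := by
    simp only [Finset.mem_insert, Finset.mem_singleton, not_or]
    exact ⟨hζ1.symm, h.1.symm⟩
  have h3 : ({1, ζ, a} : Finset T.mu).card = 3 := by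
    rw [Finset.card_insert_of_notMem h1, Finset.card_pair h.2.symm]
  have h3le : ({1, ζ, a} : Finset T.mu).card ≤ 2 := by
    refine le_trans (Finset.card_le_card fun x hx => ?_) hle
    rw [Finset.mem_filter]
    refine ⟨Finset.mem_univ _, ?_⟩
    simp only [Finset.mem_insert, Finset.mem_singleton] at hx
    rcases hx with rfl | rfl | rfl
    · exact one_pow 2
    · rw [pow_two, hζ]
    · rw [pow_two, ha]
  omega

/-! ## `Hom(Π^tp_Y/Π^tp_Ÿ, μ_N)`: the homomorphisms `Π^tp_Y → μ_N` killing `Π^tp_Ÿ` -/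

/-- For `N` odd, `Hom(Π^tp_Y/Π^tp_Ÿ, μ_N) = 1` (its values are `2`-torsion, `[Π^tp_Y : Π^tp_Ÿ] = 2`).
[cite: MochizukiEtTh2009, Cor 2.18(iv) p.63] -/
theorem homKill_eq_one_of_odd (hodd : Odd ((N : ℕ+) : ℕ)) (φ : T.PiY →* T.mu)
    (hφ : ∀ d : T.PiYdd, φ (T.inclYdd d) = 1) : φ = 1 := by
  obtain ⟨g₀, hg₀⟩ := T.exists_not_mem_PiYdd
  exact T.hom_eq_of_apply_eq hφ (φ₂ := 1) (fun _ => rfl) hg₀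
    (by rw [MonoidHom.one_apply]; exact mu_eq_one_of_mul_self_eq_one_of_odd T hodd (T.hom_apply_mul_self φ hφ g₀))

/-- `Hom(Π^tp_Y/Π^tp_Ÿ, μ_N)` has at most two elements: given `φ₀` with value `ζ` (of order `2`) off `Π^tp_Ÿ`, every
member is `1` or `φ₀`. [cite: MochizukiEtTh2009, Cor 2.18(iv) p.63] -/
theorem homKill_eq_one_or_eq {ζ : T.mu} (hζ1 : ζ ≠ 1) (hζ : ζ * ζ = 1) {g₀ : T.PiY}
    (hg₀ : g₀ ∉ T.PiYdd.subgroupOf T.PiY) {φ₀ : T.PiY →* T.mu} (hφ₀ : ∀ d : T.PiYdd, φ₀ (T.inclYdd d) = 1)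
    (hφ₀g₀ : φ₀ g₀ = ζ) (φ : T.PiY →* T.mu) (hφ : ∀ d : T.PiYdd, φ (T.inclYdd d) = 1) : φ = 1 ∨ φ = φ₀ := by
  rcases mu_eq_one_or_eq_of_mul_self_eq_one T hζ1 hζ (T.hom_apply_mul_self φ hφ g₀) with h | h
  · exact Or.inl (T.hom_eq_of_apply_eq hφ (φ₂ := 1) (fun _ => rfl) hg₀ (by rw [h, MonoidHom.one_apply]))
  · exact Or.inr (T.hom_eq_of_apply_eq hφ hφ₀ hg₀ (by rw [h, hφ₀g₀]))

/-! ## Twists by distinct members of `Hom(Π^tp_Y/Π^tp_Ÿ, μ_N)` are not `μ_N`-conjugate -/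

/-- **The fibre of Cor. 2.18 (iv) is `Hom(Π^tp_Y/Π^tp_Ÿ, μ_N)` itself, not a quotient of it**: if the `μ_N`-conjugate
by `c` of the twist `x ↦ φ(x̄)·x` equals the `μ_N`-conjugate by `c'` of the twist by `ψ`, then `φ = ψ` — the quotient
`φ/ψ` is the coboundary of `c'⁻¹c`, an element fixed by `Π^tp_Ÿ`, hence (as `Π^tp_Ÿ ↠ G_K`, i.e. `K = K̈`) by `G_K`.
[cite: MochizukiEtTh2009, Cor 2.18(iv) p.63] -/
theorem eq_of_conj_twist_eq (haug : Function.Surjective (T.aug.comp T.PiYdd.subtype))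
    {φ ψ : T.PiY →* T.mu} (hφ : ∀ d : T.PiYdd, φ (T.inclYdd d) = 1) (hψ : ∀ d : T.PiYdd, ψ (T.inclYdd d) = 1)
    {c c' : T.mu}
    (h : ∀ y : T.env,
      MulAut.conj (CycEnvelope.inMu T.augY T.chi c)
          (CycEnvelope.inMu T.augY T.chi (φ (CycEnvelope.proj T.augY T.chi y)) * y) =
        MulAut.conj (CycEnvelope.inMu T.augY T.chi c')
          (CycEnvelope.inMu T.augY T.chi (ψ (CycEnvelope.proj T.augY T.chi y)) * y)) :
    φ = ψ := by
  -- the `μ`-coordinates at the algebraic section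
  have key : ∀ p : T.PiY,
      c * φ p * (T.chi (T.augY p) c)⁻¹ = c' * ψ p * (T.chi (T.augY p) c')⁻¹ := by
    intro p
    have e := congrArg SemidirectProduct.left (h (CycEnvelope.algSection T.augY T.chi p))
    have hp : CycEnvelope.proj T.augY T.chi (CycEnvelope.algSection T.augY T.chi p) = p := rfl
    rw [hp, T.left_conj_inMu_twist_algSection, T.left_conj_inMu_twist_algSection] at e
    exact e
  -- `u := c'⁻¹ c` is fixed by `Π^tp_Ÿ`, hence by `G_K`
  have hu : ∀ g : T.G, T.chi g (c'⁻¹ * c) = c'⁻¹ * c := by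
    intro g
    obtain ⟨d, rfl⟩ := haug g
    have e := key (T.inclYdd d)
    rw [hφ d, hψ d, mul_one, mul_one] at e
    change T.chi (T.augY (T.inclYdd d)) (c'⁻¹ * c) = c'⁻¹ * c
    rw [map_mul, map_inv]
    calc (T.chi (T.augY (T.inclYdd d)) c')⁻¹ * T.chi (T.augY (T.inclYdd d)) c
        = c'⁻¹ * (c' * (T.chi (T.augY (T.inclYdd d)) c')⁻¹) * T.chi (T.augY (T.inclYdd d)) c := by group
      _ = c'⁻¹ * (c * (T.chi (T.augY (T.inclYdd d)) c)⁻¹) * T.chi (T.augY (T.inclYdd d)) c := by rw [e]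
      _ = c'⁻¹ * c := by group
  ext p
  have hup : (T.chi (T.augY p) c')⁻¹ * T.chi (T.augY p) c = c'⁻¹ * c := by
    rw [← map_inv, ← map_mul]
    exact hu (T.augY p)
  have e := key p
  calc φ p = c⁻¹ * (c * φ p * (T.chi (T.augY p) c)⁻¹) * T.chi (T.augY p) c := by group
    _ = c⁻¹ * (c' * ψ p * (T.chi (T.augY p) c')⁻¹) * T.chi (T.augY p) c := by rw [e]
    _ = c⁻¹ * c' * ψ p * ((T.chi (T.augY p) c')⁻¹ * T.chi (T.augY p) c) := by group
    _ = c⁻¹ * c' * ψ p * (c'⁻¹ * c) := by rw [hup]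
    _ = ψ p * (c⁻¹ * (c' * (c'⁻¹ * c))) := by ac_rfl
    _ = ψ p := by rw [mul_inv_cancel_left, inv_mul_cancel, mul_one]

end ThetaEnvData

end Literature.AnabelianGeometry.EtaleTheta
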